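import Mathlib
import HarnessLib
import Literature.NumberTheory.DiophantineGeometry.AbcWave0
import HarnessLib.Audit

/-!
# Sums of three squareful numbers (Browning–Van Valckenborgh 2012)

T. D. Browning and K. Van Valckenborgh, *Sums of three squareful numbers*, Experimental
Mathematics **21** (2012), 204–211, arXiv:1106.4472 [BrowningValckenborgh2012], study the
counting function
`N₁(B) = #{(x, y, z) ∈ ℕ³ primitive : x + y = z, x, y, z ≤ B, x, y, z squareful}`
of integral points of height `≤ B` on the Campana orbifold `(ℙ¹, ½[0] + ½[1] + ½[∞])` (§1), where
an integer `k` is `m`-*powerful* if `p ^ m ∣ k` for every prime `p ∣ k`, and *squareful* means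
`2`-powerful.

## Contents

* `IsPowerful m n` — `n` is `m`-powerful (§1), with the coprime multiplicativity lemma
  `isPowerful_mul_iff_of_coprime` and its abc-triple form `IsABCTriple.isPowerful_mul_iff`
  (inside an abc triple, "`abc` powerful" is the same as "`a`, `b`, `c` each powerful");
* `squarefulSumTriples B`, `squarefulSumCount B` — the set counted by `N₁(B)` and `N₁(B)` itself,
  transcribed literally from §1, with `mem_squarefulSumTriples_iff` rewriting membership through
  `IsABCTriple` (for positive `x + y = z`, primitivity of `(x, y, z)` is `Nat.Coprime x y`, and
  `x, y, z ≤ B` is `z ≤ B`);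
* `SquarefulSumUpperBound` — **Theorem 2**: `N₁(B) = O(B^{3/5} (log B)^{12})` (named fact; the
  printed proof, §4, runs Heath-Brown's determinant method through Lemma 3 of the paper, viewing
  `x₀²y₀³ + x₁²y₁³ = x₂²y₂³` as a family of conics and as a family of plane cubics);
* `squarefulSumConstant` — the conjectural leading constant `c` (`= 2.677539267` to eight digits)
  as the explicit series (2.4) of the paper (the evaluated sum (2.2) of Peyre constants of the
  conics `x₀²y₀³ + x₁²y₁³ = x₂²y₂³`), assembled from `bvvSigmaTwo` (the `2`-adic factor `σ_{2,y}`
  of Lemma 2), `bvvOddFactor` (the odd Euler factors of Lemma 1) and `bvvSummand`;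
* `SquarefulSumLowerBound` — **Theorem 1**: `N₁(B) ≥ c B^{1/2} (1 + o(1))` (named fact; the paper
  sketches its proof in §3 from the Franke–Manin–Tschinkel asymptotic formula for conics, uniformly
  in the coefficients);
* `SquarefulSumConjecture` — **Conjecture 1**: `N₁(B) ~ c B^{1/2}` (an open conjecture: a `Prop`,
  never asserted);
* `SquarefulSumUpperBound.powerfulAbcHits_le` — the corollary of Theorem 2 in the shape used by
  abc exceptional-set counts: the abc hits `a + b = c ≤ X`, `rad(abc) < c` with `abc` powerful
  number at most `C X^{3/5} (log X)^{12}`.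

## Design choices

* `O(·)` in Theorem 2 is rendered as a single constant valid for all `B ≥ 2`; this is equivalent
  to the eventual form since `N₁` is monotone in `B` (`squarefulSumCount_mono`) and
  `B^{3/5} (log B)^{12} > 0` for `B ≥ 2`.
* `N₁(B) ≥ c B^{1/2} (1 + o(1))` is rendered as `∀ ε > 0`, eventually `(1 - ε) c √B ≤ N₁(B)`;
  `N₁(B) = c B^{1/2} (1 + o(1))` as `Asymptotics.IsEquivalent` (`~[atTop]`).
* The constant `c` is the triple series (2.4) of nonnegative terms, written with `tsum` over
  `ℕ × ℕ × ℕ`. Its summability (the summand is `≪ 2^{ω(d)} d^{-3/2}` on the `3^{ω(d)}` triples with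
  `y₀y₁y₂ = d`) is **not** proved in this file: Lean's `tsum` returns the junk value `0` for a
  non-summable family, so a user who needs `0 < c` must first prove summability (the term at
  `y = (1,1,1)` alone is `1`, `bvvSummand_one`, giving `c ≥ 1/π`).
* We transcribe (2.4), not the "simplified" closed form (2.10) of the arXiv text: (2.10) uses
  "`c₀ = c₁ = c₂` by symmetry", but the class `2 ∣ y₂` is not symmetric to `2 ∣ y₀`
  (`σ_{2,(2,1,1)} = 2`, `σ_{2,(1,1,2)} = 0`: `x₀² + x₁² = 8x₂²` has no primitive solution), and a
  direct evaluation (made while vendoring this file, not taken from the paper) confirms it: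
  partial sums of (2.4) over `y₀y₁y₂ ≤ 5·10⁶` give `2.6721` with a tail `≈ 0.006`, matching the
  printed `c = 2.677539267`, while (2.10) sums to `> 3.09`; a brute-force count gives
  `N₁(10⁷) = 6562`, `N₁(3·10⁷) = 11626` (`N₁(B)/√B = 2.08, 2.12`, increasing).
* `IsPowerful m 0` holds vacuously (`Nat.primeFactors 0 = ∅`); every counting set below consists
  of positive integers, so this junk case never enters.
* `μ²(y₀y₁y₂) = 1` is written `Squarefree (y₀ * y₁ * y₂)`, which also forces every `yᵢ ≥ 1`
  (`y ∈ ℕ³` in the paper means positive integers).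

## Not here

The proofs of Theorems 1 and 2, the local density computations of §2 (Lemmas 1–2, entered only
through their values), the summability of (2.4), Table 1 / Figure 1, and the elementary lower bound
`N₁(B) ≫ B^{1/2}` from Pythagorean triples (§1).
-/

noncomputable section

open Filter Finset Asymptotics

namespace Literature.NumberTheory.DiophantineGeometry

/-! ### Powerful numbers -/

/-- A natural number `n` is `m`-*powerful* if `p ^ m ∣ n` whenever `p` is a prime divisor of `n`
(Browning–Van Valckenborgh 2012, §1, following Erdős–Szekeres 1934); `2`-powerful is called
*squareful* (= powerful, square-full). Vacuously true for `n = 0` and `n = 1`.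
[cite: BrowningValckenborgh2012, §1] -/
def IsPowerful (m n : ℕ) : Prop :=
  ∀ p ∈ n.primeFactors, p ^ m ∣ n

/-- `IsPowerful m n` is decidable (a bounded quantifier over `n.primeFactors`). [folklore] -/
instance IsPowerful.instDecidable (m n : ℕ) : Decidable (IsPowerful m n) :=
  inferInstanceAs (Decidable (∀ p ∈ n.primeFactors, p ^ m ∣ n))

/-- Unfolding lemma for `IsPowerful`. [folklore] -/
theorem isPowerful_iff (m n : ℕ) : IsPowerful m n ↔ ∀ p ∈ n.primeFactors, p ^ m ∣ n :=
  Iff.rfl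

/-- `IsPowerful m n` as a statement about all primes (true for `n = 0` on both sides). [folklore] -/
theorem isPowerful_iff_forall_prime (m n : ℕ) :
    IsPowerful m n ↔ ∀ p : ℕ, p.Prime → p ∣ n → p ^ m ∣ n := by
  rcases eq_or_ne n 0 with rfl | hn
  · simp [IsPowerful]
  · simp [IsPowerful, Nat.mem_primeFactors, hn]

/-- `1` is `m`-powerful. [folklore] -/
theorem isPowerful_one (m : ℕ) : IsPowerful m 1 := by
  simp [IsPowerful]

/-- Perfect `m`-th powers are `m`-powerful. [folklore] -/
theorem isPowerful_pow (m a : ℕ) : IsPowerful m (a ^ m) := fun _ hp =>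
  pow_dvd_pow_of_dvd
    ((Nat.prime_of_mem_primeFactors hp).dvd_of_dvd_pow (Nat.dvd_of_mem_primeFactors hp)) m

/-- For coprime nonzero `a, b`, the product `a * b` is `m`-powerful iff both factors are.
[folklore] -/
theorem isPowerful_mul_iff_of_coprime {a b : ℕ} (m : ℕ) (hab : a.Coprime b) (ha : a ≠ 0)
    (hb : b ≠ 0) : IsPowerful m (a * b) ↔ IsPowerful m a ∧ IsPowerful m b := by
  simp only [IsPowerful, Nat.primeFactors_mul ha hb, Finset.mem_union]
  constructor
  · intro h
    refine ⟨fun p hp => ?_, fun p hp => ?_⟩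
    · have hpb : (p ^ m).Coprime b :=
        (hab.coprime_dvd_left (Nat.dvd_of_mem_primeFactors hp)).pow_left m
      exact hpb.dvd_of_dvd_mul_right (h p (Or.inl hp))
    · have hpa : (p ^ m).Coprime a :=
        (hab.symm.coprime_dvd_left (Nat.dvd_of_mem_primeFactors hp)).pow_left m
      exact hpa.dvd_of_dvd_mul_left (h p (Or.inr hp))
  · rintro ⟨h₁, h₂⟩ p (hp | hp)
    exacts [(h₁ p hp).trans (dvd_mul_right a b), (h₂ p hp).trans (dvd_mul_left b a)]

/-- Inside an abc triple (positive, coprime, `a + b = c`) the three entries are pairwise coprime,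
so "`abc` is `m`-powerful" is the same as "`a`, `b`, `c` are each `m`-powerful". [folklore] -/
theorem IsABCTriple.isPowerful_mul_iff {a b c : ℕ} (h : IsABCTriple a b c) (m : ℕ) :
    IsPowerful m (a * b * c) ↔ IsPowerful m a ∧ IsPowerful m b ∧ IsPowerful m c := by
  obtain ⟨ha, hb, rfl, hab⟩ := h
  have hac : a.Coprime (a + b) := Nat.coprime_self_add_right.2 hab
  have hbc : b.Coprime (a + b) := Nat.coprime_add_self_right.2 hab.symm
  rw [isPowerful_mul_iff_of_coprime m (hac.mul_left hbc) (by positivity) (by omega),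
    isPowerful_mul_iff_of_coprime m hab ha.ne' hb.ne', and_assoc]

/-! ### The counting function `N₁(B)` -/

/-- The set counted by `N₁(B)` (Browning–Van Valckenborgh 2012, §1, the case `m = 2` of
`N_{m-1}(B)`), transcribed literally: primitive vectors `(x, y, z)` of *positive* integers with
`x + y = z`, `x, y, z ≤ B` and `x, y, z` squareful. [cite: BrowningValckenborgh2012, §1] -/
def squarefulSumTriples (B : ℕ) : Set (ℕ × ℕ × ℕ) :=
  {t | 0 < t.1 ∧ 0 < t.2.1 ∧ 0 < t.2.2 ∧ t.1 + t.2.1 = t.2.2 ∧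
    Nat.gcd t.1 (Nat.gcd t.2.1 t.2.2) = 1 ∧ t.1 ≤ B ∧ t.2.1 ≤ B ∧ t.2.2 ≤ B ∧
    IsPowerful 2 t.1 ∧ IsPowerful 2 t.2.1 ∧ IsPowerful 2 t.2.2}

/-- `N₁(B)`: the number of primitive triples of positive squareful integers `x + y = z` with
`x, y, z ≤ B` (Browning–Van Valckenborgh 2012, §1). An honest cardinality: the set is finite
(`squarefulSumTriples_finite`). [cite: BrowningValckenborgh2012, §1] -/
def squarefulSumCount (B : ℕ) : ℕ :=
  (squarefulSumTriples B).ncard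

/-- The set counted by `N₁(B)` lies in `[0, B]³`, hence is finite. [folklore] -/
theorem squarefulSumTriples_finite (B : ℕ) : (squarefulSumTriples B).Finite := by
  refine ((Set.finite_Iic B).prod ((Set.finite_Iic B).prod (Set.finite_Iic B))).subset ?_
  rintro ⟨x, y, z⟩ ⟨-, -, -, -, -, hx, hy, hz, -⟩
  simp only [Set.mem_prod, Set.mem_Iic]
  exact ⟨hx, hy, hz⟩

/-- The sets counted by `N₁(B)` increase with `B`. [folklore] -/
theorem squarefulSumTriples_mono : Monotone squarefulSumTriples := by
  rintro B B' h ⟨x, y, z⟩ ⟨h₁, h₂, h₃, h₄, h₅, hx, hy, hz, h₆, h₇, h₈⟩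
  exact ⟨h₁, h₂, h₃, h₄, h₅, hx.trans h, hy.trans h, hz.trans h, h₆, h₇, h₈⟩

/-- `N₁` is monotone in `B`. [folklore] -/
theorem squarefulSumCount_mono : Monotone squarefulSumCount := fun _ B' h =>
  Set.ncard_le_ncard (squarefulSumTriples_mono h) (squarefulSumTriples_finite B')

/-- Membership in the set counted by `N₁(B)`, rewritten through `IsABCTriple`: for positive
`x + y = z` the vector `(x, y, z)` is primitive iff `x, y` are coprime, and `x, y, z ≤ B` iff
`z ≤ B`. [folklore] -/
theorem mem_squarefulSumTriples_iff (B : ℕ) (t : ℕ × ℕ × ℕ) :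
    t ∈ squarefulSumTriples B ↔ IsABCTriple t.1 t.2.1 t.2.2 ∧ t.2.2 ≤ B ∧
      IsPowerful 2 t.1 ∧ IsPowerful 2 t.2.1 ∧ IsPowerful 2 t.2.2 := by
  obtain ⟨x, y, z⟩ := t
  have key : Nat.gcd x (Nat.gcd y (x + y)) = Nat.gcd x y := by
    rw [Nat.gcd_add_self_right, Nat.gcd_comm y x, ← Nat.gcd_assoc, Nat.gcd_self]
  simp only [squarefulSumTriples, Set.mem_setOf_eq, IsABCTriple]
  constructor
  · rintro ⟨hx, hy, -, rfl, hg, -, -, hzB, px, py, pz⟩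
    exact ⟨⟨hx, hy, rfl, by rwa [key] at hg⟩, hzB, px, py, pz⟩
  · rintro ⟨⟨hx, hy, rfl, hg⟩, hzB, px, py, pz⟩
    exact ⟨hx, hy, by omega, rfl, by rwa [key], by omega, by omega, hzB, px, py, pz⟩

/-- `N₁(B)` as the number of squareful abc triples `a + b = c ≤ B`. [folklore] -/
theorem squarefulSumCount_eq_ncard (B : ℕ) :
    squarefulSumCount B = {t : ℕ × ℕ × ℕ | IsABCTriple t.1 t.2.1 t.2.2 ∧ t.2.2 ≤ B ∧
      IsPowerful 2 t.1 ∧ IsPowerful 2 t.2.1 ∧ IsPowerful 2 t.2.2}.ncard := by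
  unfold squarefulSumCount
  congr 1
  ext t
  exact mem_squarefulSumTriples_iff B t

/-! ### Theorem 2: the upper bound -/

/-- **Browning–Van Valckenborgh 2012, Theorem 2.** `N₁(B) = O(B^{3/5} (log B)^{12})`: there is
a constant `C` with `N₁(B) ≤ C · B^{3/5} (log B)^{12}` for all `B ≥ 2` (equivalent to the
eventual `O`-statement, `N₁` being monotone). Proof (§4 of the paper): Heath-Brown's determinant
method for conics (`d = 2`) and plane cubics (`d = 3`) via Lemma 3 there. The authors remark that
the factor `log¹² B` "ought to be" removable, and that improving `3/5` needs a new treatment of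
the range `xᵢ, yᵢ ≍ B^{1/5}`. [cite: BrowningValckenborgh2012, Thm. 2] -/
def SquarefulSumUpperBound : Prop :=
  ∃ C : ℝ, ∀ B : ℕ, 2 ≤ B →
    (squarefulSumCount B : ℝ) ≤ C * (B : ℝ) ^ (3 / 5 : ℝ) * Real.log B ^ 12

/-! ### The conjectural constant `c` (formula (2.4)) -/

/-- `σ_{2,y} = lim_{r → ∞} 2^{-2r} N*_y(2^r)`, the `2`-adic density factor of the conic
`x₀²y₀³ + x₁²y₁³ = x₂²y₂³` with the integrality condition `min v₂(xᵢyᵢ) = 0`, by its table of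
values in Lemma 2 of the paper (for square-free `y₀y₁y₂`, where at most one `yᵢ` is even):
`1` if `2 ∤ y₀y₁y₂` and `¬(y₀ ≡ y₁ ≡ -y₂ (mod 4))`; `2` if `2 ∣ y₀` and `y₁ ≡ y₂ (mod 8)`; `2` if
`2 ∣ y₁` and `y₀ ≡ y₂ (mod 8)`; `2` if `2 ∣ y₂` and `y₀ ≡ -y₁ (mod 8)`; `0` otherwise.
[cite: BrowningValckenborgh2012, Lemma 2] -/
def bvvSigmaTwo (y₀ y₁ y₂ : ℕ) : ℕ :=
  if Odd (y₀ * y₁ * y₂) then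
    (if (y₀ : ℤ) ≡ (y₁ : ℤ) [ZMOD 4] ∧ (y₁ : ℤ) ≡ -(y₂ : ℤ) [ZMOD 4] then 0 else 1)
  else if Even y₀ then (if (y₁ : ℤ) ≡ (y₂ : ℤ) [ZMOD 8] then 2 else 0)
  else if Even y₁ then (if (y₀ : ℤ) ≡ (y₂ : ℤ) [ZMOD 8] then 2 else 0)
  else (if (y₀ : ℤ) ≡ -(y₁ : ℤ) [ZMOD 8] then 2 else 0)

/-- Values of `σ_{2,y}` at `y = (1,1,1), (2,1,1), (1,2,1), (1,1,2), (1,1,3)`: `1, 2, 2, 0, 0`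
(`x₀² + x₁² = 8x₂²` and `x₀² + x₁² = 27x₂²` have no primitive `2`-adic points). In particular the
three classes "`yᵢ` even" are **not** interchangeable. [cite: BrowningValckenborgh2012, Lemma 2] -/
theorem bvvSigmaTwo_values :
    bvvSigmaTwo 1 1 1 = 1 ∧ bvvSigmaTwo 2 1 1 = 2 ∧ bvvSigmaTwo 1 2 1 = 2 ∧ bvvSigmaTwo 1 1 2 = 0 ∧
      bvvSigmaTwo 1 1 3 = 0 := by
  decide

/-- The odd-prime Euler factor `∏_{p ∣ n, p > 2} (1 + (a/p)) / (1 + 1/p)` of formula (2.4)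
(`(a/p)` the Legendre symbol, written `jacobiSym a p` at the prime `p`; by Lemma 1 of the paper
`(1 - 1/p)(1 + (a/p))` is the `p`-adic density for `p ∣ yᵢ`, and `(1 - 1/p²)⁻¹` removes the `p`-th
factor of `8/π² = ∏_{p > 2} (1 - 1/p²)`). [cite: BrowningValckenborgh2012, §2.4 (2.4)] -/
def bvvOddFactor (a : ℤ) (n : ℕ) : ℝ :=
  ∏ p ∈ n.primeFactors.erase 2, (1 + (jacobiSym a p : ℝ)) / (1 + (p : ℝ)⁻¹)

/-- The summand of formula (2.4) at `y = (y₀, y₁, y₂)`: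
`μ²(y₀y₁y₂) (y₀y₁y₂)^{-3/2} σ_{2,y} ∏_{p∣y₀,p>2} (1+(y₁y₂/p))/(1+1/p)`
`∏_{p∣y₁,p>2} (1+(y₀y₂/p))/(1+1/p) ∏_{p∣y₂,p>2} (1+(-y₀y₁/p))/(1+1/p)` (zero unless `y₀y₁y₂` is
square-free, in particular unless all `yᵢ ≥ 1`). [cite: BrowningValckenborgh2012, §2.4 (2.4)] -/
def bvvSummand (y : ℕ × ℕ × ℕ) : ℝ :=
  if Squarefree (y.1 * y.2.1 * y.2.2) then
    ((y.1 * y.2.1 * y.2.2 : ℕ) : ℝ) ^ (-(3 / 2 : ℝ)) * (bvvSigmaTwo y.1 y.2.1 y.2.2 : ℝ) *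
      (bvvOddFactor ((y.2.1 : ℤ) * y.2.2) y.1 * bvvOddFactor ((y.1 : ℤ) * y.2.2) y.2.1 *
        bvvOddFactor (-((y.1 : ℤ) * y.2.1)) y.2.2)
  else 0

/-- The conjectural leading constant `c` of Browning–Van Valckenborgh 2012, formula (2.4):
`c = (1/π) Σ_{y ∈ ℕ³} μ²(y₀y₁y₂) (y₀y₁y₂)^{-3/2} σ_{2,y} ∏ ⋯` — the evaluation (§§2.1–2.4:
`α = 1/2`, good places `8/π² ∏ (1 - 1/p²)⁻¹`, Lemmas 1–2, real density `π/(y₀y₁y₂)^{3/2}`) of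
definition (2.2), `c = ¼ Σ_y μ²(y₀y₁y₂) c_{H_y}(C_y(𝔸_ℚ)⁺)`, the sum of the Peyre constants of
the conics
`C_y : x₀²y₀³ + x₁²y₁³ = x₂²y₂³`. Numerically `c = 2.677539267` to eight digits (Conjecture 1).
Written with `tsum` over `ℕ × ℕ × ℕ` (terms are nonnegative, `bvvSummand_nonneg`); summability is
not proved here. We transcribe (2.4) and **not** the paper's further "simplified" closed form
(2.10): the latter rests on "`c₀ = c₁ = c₂` by symmetry", which fails (`bvvSigmaTwo_values`:
`σ_{2,(2,1,1)} = 2` but `σ_{2,(1,1,2)} = 0`), and numerically the partial sums of (2.4) over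
`y₀y₁y₂ ≤ 5·10⁶` give `2.6721` (tail `≈ 0.006`), reproducing the printed value, whereas those of
(2.10) already exceed `3.09`. [cite: BrowningValckenborgh2012, §2.4 (2.4)] -/
def squarefulSumConstant : ℝ :=
  Real.pi⁻¹ * ∑' y : ℕ × ℕ × ℕ, bvvSummand y

/-- Each odd-prime Euler factor is nonnegative (`1 + (a/p) ≥ 0`). [folklore] -/
theorem bvvOddFactor_nonneg (a : ℤ) (n : ℕ) : 0 ≤ bvvOddFactor a n := by
  unfold bvvOddFactor
  refine Finset.prod_nonneg fun p _ => div_nonneg ?_ (by positivity)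
  rcases jacobiSym.trichotomy a p with h | h | h <;> simp [h]

/-- Every term of the series (2.4) for `c` is nonnegative. [folklore] -/
theorem bvvSummand_nonneg (y : ℕ × ℕ × ℕ) : 0 ≤ bvvSummand y := by
  unfold bvvSummand
  split_ifs
  · exact mul_nonneg (mul_nonneg (by positivity) (by positivity))
      (mul_nonneg (mul_nonneg (bvvOddFactor_nonneg _ _) (bvvOddFactor_nonneg _ _))
        (bvvOddFactor_nonneg _ _))
  · exact le_rfl

/-- The term of (2.4) at `y = (1, 1, 1)` (the conic `x₀² + x₁² = x₂²`, i.e. primitive Pythagorean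
triples) is `1`, so `c ≥ 1/π` once summability is known; cf. §1 of the paper: this term alone gives
`N₁(B) ≥ #{primitive Pythagorean triples with hypotenuse ≤ √B} ~ √B/π`. [folklore] -/
theorem bvvSummand_one : bvvSummand (1, 1, 1) = 1 := by
  have h : bvvSigmaTwo 1 1 1 = 1 := by decide
  simp [bvvSummand, bvvOddFactor, h]

/-! ### Theorem 1 and Conjecture 1 -/

/-- **Browning–Van Valckenborgh 2012, Theorem 1.** `N₁(B) ≥ c B^{1/2} (1 + o(1))` with `c` the
constant of Conjecture 1 (`squarefulSumConstant`): for every `ε > 0`,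
`(1 - ε) c √B ≤ N₁(B)` for all sufficiently large `B`. The paper *sketches* the proof (§3): Möbius
inversion of the coprimality conditions and the Franke–Manin–Tschinkel asymptotic
`N_{C,H}(P) = c_H(C(𝔸_ℚ)) P + O(M^ψ P^{1-δ})` for conics with coefficients `≤ M`, applied to the
`y` with `yᵢ ≤ B^θ`, `0 < θ < δ / (6 (1 + ψ))`. [cite: BrowningValckenborgh2012, Thm. 1] -/
def SquarefulSumLowerBound : Prop :=
  ∀ ε : ℝ, 0 < ε → ∀ᶠ B : ℕ in atTop,
    (1 - ε) * squarefulSumConstant * Real.sqrt B ≤ (squarefulSumCount B : ℝ)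

/-- **Browning–Van Valckenborgh 2012, Conjecture 1** (OPEN — recorded as a `Prop`, not asserted):
`N₁(B) = c B^{1/2} (1 + o(1))` as `B → ∞`, i.e. `N₁(B) ~ c √B`, with `c = squarefulSumConstant`
(`= 2.677539267…`); supported by Theorem 1, Theorem 2 and numerics up to `B = 10¹³` (Table 1).
[cite: BrowningValckenborgh2012, Conj. 1] -/
@[conjecture] def SquarefulSumConjecture : Prop :=
  (fun B : ℕ => (squarefulSumCount B : ℝ)) ~[atTop] fun B : ℕ => squarefulSumConstant * Real.sqrt B

/-! ### Corollary for abc hits with powerful `abc` -/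

/-- Corollary of Theorem 2 in the language of abc hits: the abc triples `a + b = c ≤ X` with
`rad(abc) < c` and `abc` powerful (every prime factor of `abc` divides it twice) form a subset of
the set counted by `N₁(X)` (by `IsABCTriple.isPowerful_mul_iff`), hence number at most
`C X^{3/5} (log X)^{12}` for `X ≥ 2`. [cite: BrowningValckenborgh2012, Thm. 2] -/
theorem SquarefulSumUpperBound.powerfulAbcHits_le (h : SquarefulSumUpperBound) :
    ∃ C : ℝ, ∀ X : ℕ, 2 ≤ X →
      ({t : ℕ × ℕ × ℕ | IsABCTriple t.1 t.2.1 t.2.2 ∧ t.2.2 ≤ X ∧ rad t.1 t.2.1 t.2.2 < t.2.2 ∧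
          ∀ p ∈ (t.1 * t.2.1 * t.2.2).primeFactors, p ^ 2 ∣ t.1 * t.2.1 * t.2.2}.ncard : ℝ) ≤
        C * (X : ℝ) ^ (3 / 5 : ℝ) * Real.log X ^ 12 := by
  obtain ⟨C, hC⟩ := h
  refine ⟨C, fun X hX => le_trans ?_ (hC X hX)⟩
  have hsub : {t : ℕ × ℕ × ℕ | IsABCTriple t.1 t.2.1 t.2.2 ∧ t.2.2 ≤ X ∧
      rad t.1 t.2.1 t.2.2 < t.2.2 ∧
      ∀ p ∈ (t.1 * t.2.1 * t.2.2).primeFactors, p ^ 2 ∣ t.1 * t.2.1 * t.2.2} ⊆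
      squarefulSumTriples X := by
    rintro t ⟨habc, htX, -, hpow⟩
    exact (mem_squarefulSumTriples_iff X t).2 ⟨habc, htX, (habc.isPowerful_mul_iff 2).1 hpow⟩
  exact_mod_cast Set.ncard_le_ncard hsub (squarefulSumTriples_finite X)

end Literature.NumberTheory.DiophantineGeometry
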